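import Summits.CriticalPhenomena.SAWScalingLimit.Theorems.SAWLoopFugacityFlowIsingBoundaryRatioRadialDefs
import Literature.Probability.LatticeModels.ScaleFrame
import HarnessLib

/-!
# The scale frame of a finite volume read through the chordal chart (line `fk-anchor-transfer`, rev 11)
(crux `SAWLoopFugacityFlow.IsingBoundaryRatio`, stmt-CriticalPhenomena-10650)

A one-definition module. The abstract Kesten–Basu–Sapozhnikov machinery of the FK heart
(`Literature.Probability.LatticeModels.ScaleFrame`: regions by a radius function, RSW predicates
`SepBound` / `NoCrossBound` / `RadialBound`, `LadderRSW`) is instantiated on the vertex type `↥Λ` of a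
finite volume `Λ` agreeing locally with the mesh graph `Ω_δ` near the marked prime end `a = D.pt 0`:

* `chartFrame D φ ε δ Λ H η R hη hadj` — edges = those of the graph `H` on `↥Λ` (in the application
  `H = G.comap Subtype.val` for a supergraph `G`, or `Ω_δ.comap Subtype.val`), radius
  `rad v = ‖φ⁻¹(δ v)‖` (chordal chart radius of the mesh point), good vertices = MESH sites
  (`meshDomain`) with mesh point in the ball `B(a, ε)`, continuity modulus `η`, ceiling `R`; the field
  `adj_good` is supplied as the hypothesis `hadj` (it holds eventually as `δ → 0`, by local agreement and
  the uniform continuity of the Carathéodory extension of `φ⁻¹` — proved in the companion files, not here).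

With this choice `(chartFrame …).annSet ρ (Mρ) = annBody D φ M ε δ ρ Λ ∩ {mesh sites}`, its
`edgesTouching` of that annulus is `annEdgeFinset H (annBody …)` (non-mesh sites of `Λ` in the ball are
isolated in `H`), `inSet ρ ⊆ annIn D φ ε δ ρ Λ`, and the frame events `sepEvent` / `radCross` are implied by /
imply the line's `AnnPathSepG` / `AnnCross` — so the three registered RSW clauses of the line feed
`LadderRSW` (companion files). Nothing is asserted here.
-/

noncomputable section

open scoped Classical Topology
open Filter Set Metric SimpleGraph
open Literature.Probability.LatticeModels Literature.Probability.RandomPlanarGeometry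
open UpperHalfPlane (upperHalfPlaneSet)

namespace Summit.CriticalPhenomena.SAWScalingLimit.Theorems.IsingBoundaryRatio

/-- **The scale frame of the volume `Λ` with graph `H`, read through the chordal chart `φ`** (see the
module docstring): radius = chart radius of the mesh point, good = mesh sites in `B(a, ε)`, modulus `η`,
ceiling `R`; the adjacency axiom of `ScaleFrame` is the hypothesis `hadj`. [folklore] -/
def chartFrame (D : DobrushinDomain) (φ : ConformalEquiv upperHalfPlaneSet D.carrier) (ε δ : ℝ)
    (Λ : Finset (Site 2)) (H : SimpleGraph Λ) (η R : ℝ) (hη : 0 < η)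
    (hadj : ∀ e ∈ H.edgeFinset, ∀ u ∈ e, ∀ v ∈ e,
      (u.1 ∈ meshDomain D.carrier δ ∧ meshPoint δ u.1 ∈ Metric.ball (D.pt 0) ε) →
      ‖φ.symm (meshPoint δ u.1)‖ < R →
        (v.1 ∈ meshDomain D.carrier δ ∧ meshPoint δ v.1 ∈ Metric.ball (D.pt 0) ε) ∧
          |‖φ.symm (meshPoint δ v.1)‖ - ‖φ.symm (meshPoint δ u.1)‖| < η) :
    ScaleFrame Λ where
  E := H.edgeFinset
  rad := fun v => ‖φ.symm (meshPoint δ v.1)‖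
  good := {v | v.1 ∈ meshDomain D.carrier δ ∧ meshPoint δ v.1 ∈ Metric.ball (D.pt 0) ε}
  η := η
  Rmax := R
  η_pos := hη
  adj_good := hadj

/-- The edge set of the chart frame is the edge set of `H`. [folklore] -/
@[simp] theorem chartFrame_E (D : DobrushinDomain) (φ : ConformalEquiv upperHalfPlaneSet D.carrier) (ε δ : ℝ)
    (Λ : Finset (Site 2)) (H : SimpleGraph Λ) (η R : ℝ) (hη : 0 < η) (hadj) :
    (chartFrame D φ ε δ Λ H η R hη hadj).E = H.edgeFinset := rfl

/-- The radius of the chart frame is the chart radius of the mesh point. [folklore] -/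
@[simp] theorem chartFrame_rad (D : DobrushinDomain) (φ : ConformalEquiv upperHalfPlaneSet D.carrier) (ε δ : ℝ)
    (Λ : Finset (Site 2)) (H : SimpleGraph Λ) (η R : ℝ) (hη : 0 < η) (hadj) (v : Λ) :
    (chartFrame D φ ε δ Λ H η R hη hadj).rad v = ‖φ.symm (meshPoint δ v.1)‖ := rfl

/-- The good vertices of the chart frame are the mesh sites in the ball. [folklore] -/
theorem mem_chartFrame_good (D : DobrushinDomain) (φ : ConformalEquiv upperHalfPlaneSet D.carrier) (ε δ : ℝ)
    (Λ : Finset (Site 2)) (H : SimpleGraph Λ) (η R : ℝ) (hη : 0 < η) (hadj) (v : Λ) :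
    v ∈ (chartFrame D φ ε δ Λ H η R hη hadj).good ↔
      v.1 ∈ meshDomain D.carrier δ ∧ meshPoint δ v.1 ∈ Metric.ball (D.pt 0) ε := Iff.rfl

/-- The annulus of the chart frame lies in the line's `annBody` (registered sub-goal of
stmt-CriticalPhenomena-10650; the converse inclusion holds for mesh sites). [folklore] -/
theorem chartFrame_annSet_subset_annBody : ∀ (D : DobrushinDomain) (φ : ConformalEquiv upperHalfPlaneSet D.carrier) (M ε δ ρ : ℝ) (Λ : Finset (Site 2)) (H : SimpleGraph Λ) (η R : ℝ) (hη : 0 < η) (hadj : ∀ e ∈ H.edgeFinset, ∀ u ∈ e, ∀ v ∈ e, (u.1 ∈ meshDomain D.carrier δ ∧ meshPoint δ u.1 ∈ Metric.ball (D.pt 0) ε) → ‖φ.symm (meshPoint δ u.1)‖ < R → (v.1 ∈ meshDomain D.carrier δ ∧ meshPoint δ v.1 ∈ Metric.ball (D.pt 0) ε) ∧ |‖φ.symm (meshPoint δ v.1)‖ - ‖φ.symm (meshPoint δ u.1)‖| < η), (chartFrame D φ ε δ Λ H η R hη hadj).annSet ρ (M * ρ) ⊆ annBody D φ M ε δ ρ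 Λ := by
  intro D φ M ε δ ρ Λ H η R hη hadj v hv
  rw [ScaleFrame.mem_annSet, mem_chartFrame_good, chartFrame_rad] at hv
  exact ⟨hv.1.2, hv.2.1, hv.2.2⟩

end Summit.CriticalPhenomena.SAWScalingLimit.Theorems.IsingBoundaryRatio

end
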